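import Literature.NumberTheory.EllipticCurves.BSDSelmerCMPConverseProofs
import Literature.NumberTheory.EllipticCurves.SelmerCorankHolds
import HarnessLib

/-!
# CM curves over `ℚ`: an algebraic `p^∞`-Selmer certificate at ONE prime gives full BSD

Sibling *proofs* file (theorems only: no definition, no named fact, no instance) composing two
named facts of the tree, both PRINTED AND REFEREED and both admitting **every prime `p`,
including `p = 2`**:

* `Literature.NumberTheory.EllipticCurves.burungaleTian_analyticRank_eq_zero_of_selmerCorank_eq_zero_of_hasCM`
  — A. A. Burungale, Y. Tian, *A rank zero `p`-converse to a theorem of Gross–Zagier, Kolyvagin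
  and Rubin*, Ann. of Math. (2) 203 (2026), 1–13, **Theorem 1.1** ("Let `p` be a prime" — no
  parity, reduction or image hypothesis; p. 2: "the prime `p = 2` … is excluded by the results of
  [17], [18]" = Rubin 1991/1994, whose hypothesis `p ∤ #𝓞_K^×` rules out `2`): for a CM elliptic
  curve `E/ℚ`, `corank_{ℤ_p} Sel_{p^∞}(E/ℚ) = 0 ⟹ ord_{s=1} L(E, s) = 0`;
* `Literature.NumberTheory.EllipticCurves.bsdTriple_of_hasCM_of_L_one_ne_zero` (bsd.S28) —
  A. Burungale, M. Flach, *The conjecture of Birch and Swinnerton-Dyer for certain elliptic curves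
  with complex multiplication*, Camb. J. Math. 12 (2024) 357–415 = arXiv:2206.09874, **Thm. 1.1
  and Cor. 2** with the over-`ℚ` sentence following Cor. 2 (arXiv p. 4): "Any CM elliptic curve
  `E/ℚ` with `L(E/ℚ, 1) ≠ 0` satisfies the assumptions of Corollary 2" (full BSD formula at EVERY
  prime; proved in the tree from the Burungale–Flach facts by
  `bsdTriple_of_hasCM_of_L_one_ne_zero_of_BurungaleFlach2024`);

through the Deuring–Hecke continuation `hasEntireLFunction_of_j_mem_maximalCMJInvariants`
(Silverman, *Advanced Topics*, Cor. II.10.5.1; a special case of modularity,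
`hasEntireLFunction_of_j_mem_maximalCMJInvariants_of_hasEntireLFunction_rat`), which turns
`ord_{s=1} L(E, s) = 0` into `L(E, 1) ≠ 0` (`L_one_ne_zero_of_burungaleTian_of_deuringHecke`,
`BSDSelmerCMPConverseProofs`).

## Statements

For an elliptic curve `E/ℚ` with (geometric) complex multiplication, given by a globally minimal
model `W`, and ANY prime `p`:

* `bsdTriple_of_hasCM_of_finite_selmerGroupPInfty`: `Sel_{p^∞}(E/ℚ)` finite ⟹ `W.BSDTriple`
  (rank part, finiteness of `Ш(E/ℚ)`, and the full leading-term formula — at every prime);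
* `bsdTriple_of_hasCM_of_selmerCorank_eq_zero`: the same from `corank_{ℤ_p} Sel_{p^∞}(E/ℚ) = 0`;
* `bsdTriple_of_hasCM_of_mordellWeilRank_eq_zero_of_finite_shaPrimary`: the same from
  `rank E(ℚ) = 0` and `Ш(E/ℚ)[p^∞]` finite (Greenberg's corank identity
  `s_p = r + corank Ш[p^∞]`, tree theorems `selmerCorank_eq_mordellWeilRank_add_holds` and
  `finite_primaryComponent_sha_iff_shaCorank_eq_zero`);
* `…_of_hasEntireLFunction_rat` variants: the Deuring–Hecke leaf replaced by the modularity
  leaf `hasEntireLFunction_rat`.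

## Why this is recorded (sub-lane «bsd-p2», the prime `2`)

At `p = 2` the hypothesis of the third theorem is exactly what a complete `2`-descent with the
Cassels–Tate pairing delivers (rank `0` and `Ш(E/ℚ)[2^∞]` finite and explicit), with NO
analytic input. Hence every PRINTED algebraic family of CM curves with `rank 0` and
`Ш[2^∞]` determined — e.g. Wang Zhangjie, Sci. China Math. 59 (2016) 2145–2166, Thm. 1
(`Ш(E_n/ℚ)[2^∞] ≅ (ℤ/2)²`) and Thm. 2 (`Ш(E_n/ℚ)[2^∞] ≅ (ℤ/2)^{2k}`) for the congruent number
curves `E_n : y² = x³ - n²x` (arXiv:1511.03810, p. 3) — becomes a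
family for which the FULL Birch–Swinnerton-Dyer formula, in particular its `2`-part with
`#Ш[2^∞] = 4, 16, …`, holds, by Burungale–Tian 2026 (at `p = 2`) and Burungale–Flach 2024. No
single paper prints this combination; it is a theorem about the tree's named facts, not a
transcription. Nothing here is specific to `2`: the statements are for any prime `p`.

References: A. A. Burungale, Y. Tian, Ann. of Math. (2) 203 (2026), Thm. 1.1; A. Burungale,
M. Flach, Camb. J. Math. 12 (2024), Thm. 1.1, Cor. 2; R. Greenberg, LNM 1716 (1999), §1;
J. H. Silverman, *Advanced Topics in the Arithmetic of Elliptic Curves*, Cor. II.10.5.1;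
Wang Zhangjie, Sci. China Math. 59 (2016), Thms. 1–2 (arXiv:1511.03810).
-/

noncomputable section

open scoped Classical

open WeierstrassCurve

namespace Literature.NumberTheory.EllipticCurves

/-- **CM and `Sel_{p^∞}(E/ℚ)` finite for one prime `p` ⟹ full BSD.** For `E/ℚ` with complex
multiplication (globally minimal model `W`) and any prime `p`: if `Sel_{p^∞}(E/ℚ)` is finite then
`W.BSDTriple` holds — Burungale–Tian's rank-zero `p`-converse (`hBT`, Ann. of Math. 203 (2026)
Thm. 1.1, every `p` incl. `2`) gives `ord_{s=1} L(E, s) = 0`, the Deuring–Hecke continuation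
(`hH`) turns it into `L(E, 1) ≠ 0` (`L_one_ne_zero_of_burungaleTian_of_deuringHecke`), and
Burungale–Flach (`hBF` = bsd.S28, Camb. J. Math. 12 (2024) Cor. 2) gives the full formula.
[cite: BurungaleTian2026, Thm. 1.1] [cite: BurungaleFlach2024, Thm 1.1 and Cor. 2]
[cite: SilvermanATAEC1994, Ch. II Cor. 10.5.1] -/
theorem bsdTriple_of_hasCM_of_finite_selmerGroupPInfty
    (hBT : burungaleTian_analyticRank_eq_zero_of_selmerCorank_eq_zero_of_hasCM)
    (hH : hasEntireLFunction_of_j_mem_maximalCMJInvariants)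
    (hBF : bsdTriple_of_hasCM_of_L_one_ne_zero)
    (W : WeierstrassCurve ℚ) [W.IsElliptic] [W.IsGloballyMinimal] (hCM : W.HasCM)
    (p : ℕ) [Fact p.Prime] (hfin : Finite (selmerGroupPInfty W p)) : W.BSDTriple :=
  hBF W hCM (L_one_ne_zero_of_burungaleTian_of_deuringHecke hBT hH W hCM p hfin)

/-- **CM and `corank_{ℤ_p} Sel_{p^∞}(E/ℚ) = 0` for one prime `p` ⟹ full BSD** (the corank form
of `bsdTriple_of_hasCM_of_finite_selmerGroupPInfty`, through
`finite_selmerGroupPInfty_iff_selmerCorank_eq_zero`).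
[cite: BurungaleTian2026, Thm. 1.1] [cite: BurungaleFlach2024, Thm 1.1 and Cor. 2] -/
theorem bsdTriple_of_hasCM_of_selmerCorank_eq_zero
    (hBT : burungaleTian_analyticRank_eq_zero_of_selmerCorank_eq_zero_of_hasCM)
    (hH : hasEntireLFunction_of_j_mem_maximalCMJInvariants)
    (hBF : bsdTriple_of_hasCM_of_L_one_ne_zero)
    (W : WeierstrassCurve ℚ) [W.IsElliptic] [W.IsGloballyMinimal] (hCM : W.HasCM)
    (p : ℕ) [Fact p.Prime] (h0 : W.selmerCorank p = 0) : W.BSDTriple :=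
  bsdTriple_of_hasCM_of_finite_selmerGroupPInfty hBT hH hBF W hCM p
    ((finite_selmerGroupPInfty_iff_selmerCorank_eq_zero W p).2 h0)

/-- **CM, `rank E(ℚ) = 0` and `Ш(E/ℚ)[p^∞]` finite for one prime `p` ⟹ full BSD** — the
descent form: by Greenberg's corank identity `corank Sel_{p^∞} = rank + corank Ш[p^∞]`
(`selmerCorank_eq_mordellWeilRank_add_holds`) and `Ш[p^∞]` finite `↔ corank Ш[p^∞] = 0`
(`finite_primaryComponent_sha_iff_shaCorank_eq_zero`) the Selmer corank vanishes, and
`bsdTriple_of_hasCM_of_selmerCorank_eq_zero` applies. At `p = 2` the hypotheses are the output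
of a complete `2`-descent with the Cassels–Tate pairing (e.g. Wang, Sci. China Math. 59 (2016),
Thms. 1–2: `rank E_n(ℚ) = 0`, `Ш(E_n/ℚ)[2^∞] ≅ (ℤ/2)^{2k}` for explicit congruent number curves),
so such printed algebraic families satisfy the full BSD formula, `2`-part included.
[cite: BurungaleTian2026, Thm. 1.1] [cite: BurungaleFlach2024, Thm 1.1 and Cor. 2]
[cite: Greenberg1999LNM, §1 pp. 54–57] -/
theorem bsdTriple_of_hasCM_of_mordellWeilRank_eq_zero_of_finite_shaPrimary
    (hBT : burungaleTian_analyticRank_eq_zero_of_selmerCorank_eq_zero_of_hasCM)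
    (hH : hasEntireLFunction_of_j_mem_maximalCMJInvariants)
    (hBF : bsdTriple_of_hasCM_of_L_one_ne_zero)
    (W : WeierstrassCurve ℚ) [W.IsElliptic] [W.IsGloballyMinimal] (hCM : W.HasCM)
    (p : ℕ) [Fact p.Prime] (hr : W.mordellWeilRank = 0)
    (hsha : Finite (AddCommGroup.primaryComponent W.sha p)) : W.BSDTriple := by
  refine bsdTriple_of_hasCM_of_selmerCorank_eq_zero hBT hH hBF W hCM p ?_
  simp only [W.selmerCorank_eq_mordellWeilRank_add_holds p, hr,
    (finite_primaryComponent_sha_iff_shaCorank_eq_zero W p).1 hsha]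

/-- `bsdTriple_of_hasCM_of_finite_selmerGroupPInfty` with the Deuring–Hecke leaf replaced by the
modularity leaf `hasEntireLFunction_rat` (of which it is the special case
`hasEntireLFunction_of_j_mem_maximalCMJInvariants_of_hasEntireLFunction_rat`).
[cite: BurungaleTian2026, Thm. 1.1] [cite: BurungaleFlach2024, Thm 1.1 and Cor. 2]
[cite: BCDTJAMS2001, Theorem A] -/
theorem bsdTriple_of_hasCM_of_finite_selmerGroupPInfty_of_hasEntireLFunction_rat
    (hBT : burungaleTian_analyticRank_eq_zero_of_selmerCorank_eq_zero_of_hasCM)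
    (hmod : hasEntireLFunction_rat) (hBF : bsdTriple_of_hasCM_of_L_one_ne_zero)
    (W : WeierstrassCurve ℚ) [W.IsElliptic] [W.IsGloballyMinimal] (hCM : W.HasCM)
    (p : ℕ) [Fact p.Prime] (hfin : Finite (selmerGroupPInfty W p)) : W.BSDTriple :=
  bsdTriple_of_hasCM_of_finite_selmerGroupPInfty hBT
    (hasEntireLFunction_of_j_mem_maximalCMJInvariants_of_hasEntireLFunction_rat hmod) hBF W hCM p
    hfin

/-- `bsdTriple_of_hasCM_of_mordellWeilRank_eq_zero_of_finite_shaPrimary` with the modularity leaf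
`hasEntireLFunction_rat` in place of Deuring–Hecke.
[cite: BurungaleTian2026, Thm. 1.1] [cite: BurungaleFlach2024, Thm 1.1 and Cor. 2]
[cite: Greenberg1999LNM, §1 pp. 54–57] [cite: BCDTJAMS2001, Theorem A] -/
theorem bsdTriple_of_hasCM_of_mordellWeilRank_eq_zero_of_finite_shaPrimary_of_hasEntireLFunction_rat
    (hBT : burungaleTian_analyticRank_eq_zero_of_selmerCorank_eq_zero_of_hasCM)
    (hmod : hasEntireLFunction_rat) (hBF : bsdTriple_of_hasCM_of_L_one_ne_zero)
    (W : WeierstrassCurve ℚ) [W.IsElliptic] [W.IsGloballyMinimal] (hCM : W.HasCM)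
    (p : ℕ) [Fact p.Prime] (hr : W.mordellWeilRank = 0)
    (hsha : Finite (AddCommGroup.primaryComponent W.sha p)) : W.BSDTriple :=
  bsdTriple_of_hasCM_of_mordellWeilRank_eq_zero_of_finite_shaPrimary hBT
    (hasEntireLFunction_of_j_mem_maximalCMJInvariants_of_hasEntireLFunction_rat hmod) hBF W hCM p
    hr hsha

end Literature.NumberTheory.EllipticCurves

end
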